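import Summits.ValiantsHypothesis.ValiantsHypothesis.Theorems.KPlusLogSqLawTropicalPermutationChanges

/-!
# Route `KPlusLogSqLaw`, crux `TropicalB` — the CYCLIC BIDIAGONAL support: two permutations, a linear bound

HONEST FRAMING.  Helper toward the registered stubs `stub_tropThin` / `stub_tropFat` of
`Cruxes/TropicalB/Lines/birth.lean` (crux `Summit.ValiantsHypothesis.ValiantsHypothesis.Theses.KPlusLogSqLaw.TropicalB`,
ledger item `stmt-ValiantsHypothesis-19771`, route `KPlusLogSqLaw`; cell `pub-symmetroid`, seat `val-sym-trop-p3`,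
2026-08-26).  A small SUPPORT sector with a LINEAR bound (register census: «a cyclic flip register carries two monotone
digits»); nothing here bounds `TropicalB` for general designs, and nothing bears on `KPlusLogSqLaw`, `MatrixDescartes`
or `VP ≠ VNP`.

If every present entry of a design on `Fin (n+1)` lies on the diagonal or the cyclic subdiagonal
(`ε a b l ≠ 0 → a = b ∨ a = b + 1`, addition mod `n+1`), a present permutation `σ` satisfies `σ b ∈ {b, b+1}` for all
`b`, hence is the identity or the full rotation `finRotate (n+1)` (`perm_eq_one_or_finRotate`: one subdiagonal entry
forces all of them, by injectivity around the cycle).  So every chain uses at most TWO permutations and the permutation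
fibre (val-sym-lift-p2's `succ_le_card_perms_mul`) gives `cyclicBidiagonal_chain_le : N + 1 ≤ 2·((n+1)(K−1)+1)` —
LINEAR in the size, inside val-sym-trop-p5's Hessenberg class (where the general bound is quasi-polynomial).
[folklore]
-/

set_option linter.dupNamespace false
set_option autoImplicit false

namespace Summit.ValiantsHypothesis.ValiantsHypothesis.Theorems.KPlusLogSqLaw

open Summit.ValiantsHypothesis.ValiantsHypothesis.Theorems.MatrixDescartes.Negative
open Summit.ValiantsHypothesis.ValiantsHypothesis.Theorems.LacunarySymmetroidMatrixDescartes
open Summit.ValiantsHypothesis.ValiantsHypothesis.Theorems.LacunarySymmetroidMatrixDescartes.TropicalCensus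
open scoped BigOperators
open Finset

section CyclicBidiagonal

variable {n K : ℕ}

/-- **A permutation moving every point by `0` or `+1` (cyclically) is the identity or the full rotation.** [folklore] -/
theorem perm_eq_one_or_finRotate (σ : Equiv.Perm (Fin (n + 1))) (hσ : ∀ b, σ b = b ∨ σ b = b + 1) :
    σ = 1 ∨ σ = finRotate (n + 1) := by
  rcases Nat.eq_zero_or_pos n with hn | hn
  · subst hn
    left
    ext b
    have : (b : ℕ) = 0 := by omega
    have : ((σ b : Fin 1) : ℕ) = 0 := by omega
    omega
  by_cases h : ∃ b, σ b = b + 1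
  · right
    obtain ⟨b₀, hb₀⟩ := h
    set s : Equiv.Perm (Fin (n + 1)) := finRotate (n + 1) with hs
    have hs1 : ∀ x : Fin (n + 1), s x = x + 1 := fun x => by rw [hs, finRotate_apply]
    have hfix : ∀ x : Fin (n + 1), s x ≠ x := by
      intro x hx
      rw [hs1] at hx
      have h1 : (1 : Fin (n + 1)) = 0 := by simpa using hx
      have := congrArg Fin.val h1
      rw [Fin.val_one', Fin.val_zero, Nat.mod_eq_of_lt (by omega)] at this
      exact one_ne_zero this
    -- around the cycle, every point is moved
    have hall : ∀ j : ℕ, σ ((s ^ j) b₀) = (s ^ (j + 1)) b₀ := by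
      intro j
      induction j with
      | zero => simpa [hs1] using hb₀
      | succ j ih =>
        rcases hσ ((s ^ (j + 1)) b₀) with h1 | h1
        · -- then `σ` would hit `s^(j+1) b₀` twice
          exfalso
          have heq : (s ^ (j + 1)) b₀ = (s ^ j) b₀ := σ.injective (h1.trans ih.symm)
          rw [pow_succ', Equiv.Perm.mul_apply] at heq
          exact hfix _ heq
        · rw [h1, ← hs1, ← Equiv.Perm.mul_apply, ← pow_succ']
    ext b
    have hcyc : (finRotate (n + 1)).IsCycle := isCycle_finRotate_of_le (by omega)
    obtain ⟨j, hj⟩ := hcyc.exists_pow_eq (hfix b₀) (hfix b)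
    rw [← hs] at hj
    have := hall j
    rw [hj, pow_succ', Equiv.Perm.mul_apply, hj] at this
    rw [this]
  · left
    push Not at h
    ext b
    rcases hσ b with h1 | h1
    · simpa using congrArg Fin.val h1
    · exact absurd h1 (h b)

/-- the permutation of a present term of a cyclic-bidiagonal design is `1` or `finRotate (n+1)`. [folklore] -/
theorem perm_mem_pair_of_present (ε : Fin (n + 1) → Fin (n + 1) → Fin K → ℤ)
    (hε : ∀ a b l, ε a b l ≠ 0 → a = b ∨ a = b + 1) (q : Equiv.Perm (Fin (n + 1)) × (Fin (n + 1) → Fin K))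
    (hq : termSign ε q ≠ 0) : q.1 ∈ ({1, finRotate (n + 1)} : Finset (Equiv.Perm (Fin (n + 1)))) := by
  have hpres : ∀ i, ε (q.1 i) i (q.2 i) ≠ 0 := present_of_termSign_ne_zero ε q hq
  rcases perm_eq_one_or_finRotate q.1 (fun b => hε _ _ _ (hpres b)) with h | h
  · rw [h]; simp
  · rw [h]; simp

/-- **Cyclic-bidiagonal designs: a LINEAR bound.**  Every sign-alternating dominant chain of a design on `Fin (n+1)`
supported on the diagonal and the cyclic subdiagonal has `N + 1 ≤ 2·((n+1)(K−1)+1)` terms (two permutations, each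
carrying at most `(n+1)(K−1)+1` terms by val-sym-lift-p2's permutation fibre). [folklore] -/
theorem cyclicBidiagonal_chain_le (d : Fin K → ℕ) (v ε : Fin (n + 1) → Fin (n + 1) → Fin K → ℤ)
    (hε : ∀ a b l, ε a b l ≠ 0 → a = b ∨ a = b + 1)
    {N : ℕ} (θ : Fin (N + 1) → ℤ) (p : Fin (N + 1) → Equiv.Perm (Fin (n + 1)) × (Fin (n + 1) → Fin K))
    (hθ : StrictMono θ) (hdom : ∀ k, IsDominant d v ε (θ k) (p k))
    (halt : ∀ k : Fin N, termSign ε (p k.castSucc) * termSign ε (p k.succ) < 0) :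
    N + 1 ≤ 2 * ((n + 1) * (K - 1) + 1) := by
  classical
  have h := succ_le_card_perms_mul d v ε N θ p hθ hdom halt
  have hsub : (univ.image fun k => (p k).1) ⊆ ({1, finRotate (n + 1)} : Finset (Equiv.Perm (Fin (n + 1)))) := by
    intro σ hσ
    obtain ⟨k, _, rfl⟩ := mem_image.mp hσ
    exact perm_mem_pair_of_present ε hε (p k) (hdom k).1
  have hcard : (univ.image fun k => (p k).1).card ≤ 2 := (card_le_card hsub).trans (card_le_two)
  calc N + 1 ≤ (univ.image fun k => (p k).1).card * ((n + 1) * (K - 1) + 1) := h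
    _ ≤ 2 * ((n + 1) * (K - 1) + 1) := Nat.mul_le_mul_right _ hcard

end CyclicBidiagonal

end Summit.ValiantsHypothesis.ValiantsHypothesis.Theorems.KPlusLogSqLaw
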